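import Literature.Probability.LatticeModels.GermRegionLattice
import Literature.Probability.LatticeModels.BoundaryHarnackContraction
import Literature.Probability.LatticeModels.MartinRatioBoundaryLimit
import HarnessLib

/-!
# Uniform boundary Harnack for the edge-killed walk from the one-annulus cross-ratio bound

Topic `Literature/Probability/LatticeModels` (continuation of `GermRegionLattice.lean`,
`BoundaryHarnackContraction.lean`, `MartinRatioBoundaryLimit.lean`). This file runs Chelkak–Wan's
multi-scale contraction (2021, Prop. 3.6 ⇒ Cor. 3.8) over the lattice germ regions
`Θ_δ(s_j) = germSites D b s_j g o δ` at a boundary point `b` of a Jordan domain `D`: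

* `crossDiff_mixture_le`, `crossDiff_iterate_fin` — the algebra (a mixture step without kernel
  bound; the finite-horizon iteration of `crossDiff_contraction`);
* `uniformBHP_at_of_crossRatio` — **if** for scales `s < s' = K s < s₀` the exit kernels
  `P = killedPoisson (Ω^δ) Θ_δ(s')` satisfy the crude bound `P(u,x)P(v,y) ≤ C P(v,x)P(u,y)` for exits
  `u, v` of `Θ_δ(s)` and `x, y` of `Θ_δ(s')`, eventually as `δ → 0`, **then** for all `R, η > 0` there
  is `r > 0` with `h₁(z)h₂(z') ≤ (1+η) h₁(z')h₂(z)` on the sites within `r` of `b`, eventually in `δ`,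
  for all nonnegative `h₁, h₂` harmonic for the edge-killed walk at the sites within `R` of `b`.
  Ingredients: far point `o ∈ D`, master scale below the thresholds of
  `exists_germRegion_subset_closedBall` (so `Θ_δ(s₀) ⊆ B(b,R/2)`), `twoOff_boxJD`, the ULC germ
  `exists_ball_inter_subset_chamber` (so `B(b,r) ∩ Ω_δ ⊆ Θ_δ(s_q)`), `germExits_subset_germSites`
  (exits of `Θ_δ(s_{j+1})` are sites of `Θ_δ(s_j)` once `2δ < s_j − s_{j+1}`), the representation
  `IsKilledHarmonicOn.eq_sum_killedPoisson`, and `q` scales with `k^q (2+η) ≤ η`, `k = (C−1)/(C+1)`;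
* `uniformBHP_of_crossRatio`, `KozdronLawler2005_martinRatioBoundaryLimit_of_crossRatio` — the
  global wrappers: the fact `KozdronLawler2005_martinRatioBoundaryLimit` follows from the
  one-annulus cross-ratio bound at every boundary point (via
  `KozdronLawler2005_martinRatioBoundaryLimit_of_uniformBHP`).

Everything is proved; the remaining input is the hypothesis `hcore` (the scale-invariant crude
boundary Harnack inequality for the edge-killed walk, Chelkak–Wan 2021 Prop. 3.6 / Chelkak 2016 §3).
[cite: ChelkakWan2021, Proposition 3.6, Lemma 3.7, Corollary 3.8]
-/

noncomputable section

open Set Metric Filter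
open scoped Topology

/-! ## The Chelkak–Wan contraction over the germ regions: uniform BHP from the one-annulus bound -/

namespace Literature.Probability.LatticeModels

open Literature.Topology.PlaneTopology hiding box mem_box box_mono ball_subset_box box_subset_closedBox mem_box_self
open Literature.Topology.PlaneTopology renaming box → pbox, mem_box → mem_pbox, box_mono → pbox_mono,
  ball_subset_box → ball_subset_pbox, box_subset_closedBox → pbox_subset_closedBox, mem_box_self → mem_pbox_self
open Literature.Probability.RandomPlanarGeometry (JordanDomain)
open Finset BoundaryHarnackContraction

section Algebra

variable {ι κ : Type*}

/-- **Mixture step without a kernel bound.** If `h_i(u) = Σ_{x ∈ T} K(u,x) H_i(x)` with `K ≥ 0` and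
the outer values satisfy `|H₁(x)H₂(y) − H₁(y)H₂(x)| ≤ M (H₁(x)H₂(y) + H₁(y)H₂(x))`, then the same
bound (same `M`) holds for `(h₁, h₂)` on `S`. [cite: ChelkakWan2021, proof of Corollary 3.8] -/
theorem crossDiff_mixture_le (S : Set ι) (T : Finset κ) (K : ι → κ → ℝ) (H₁ H₂ : κ → ℝ)
    (h₁ h₂ : ι → ℝ) {M : ℝ} (hK : ∀ u ∈ S, ∀ x ∈ T, 0 ≤ K u x)
    (hrep₁ : ∀ u ∈ S, h₁ u = ∑ x ∈ T, K u x * H₁ x)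
    (hrep₂ : ∀ u ∈ S, h₂ u = ∑ x ∈ T, K u x * H₂ x)
    (hout : ∀ x ∈ T, ∀ y ∈ T,
      |H₁ x * H₂ y - H₁ y * H₂ x| ≤ M * (H₁ x * H₂ y + H₁ y * H₂ x)) :
    ∀ u ∈ S, ∀ v ∈ S,
      |h₁ u * h₂ v - h₁ v * h₂ u| ≤ M * (h₁ u * h₂ v + h₁ v * h₂ u) := by
  intro u hu v hv
  have hA : h₁ u * h₂ v = ∑ x ∈ T, ∑ y ∈ T, K u x * K v y * (H₁ x * H₂ y) := by
    rw [hrep₁ u hu, hrep₂ v hv, Finset.sum_mul_sum]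
    refine Finset.sum_congr rfl fun x _ => Finset.sum_congr rfl fun y _ => ?_
    ring
  have hB : h₁ v * h₂ u = ∑ x ∈ T, ∑ y ∈ T, K u x * K v y * (H₁ y * H₂ x) := by
    rw [hrep₁ v hv, hrep₂ u hu, Finset.sum_mul_sum, Finset.sum_comm]
    refine Finset.sum_congr rfl fun x _ => Finset.sum_congr rfl fun y _ => ?_
    ring
  have hdiff : h₁ u * h₂ v - h₁ v * h₂ u =
      ∑ x ∈ T, ∑ y ∈ T, K u x * K v y * (H₁ x * H₂ y - H₁ y * H₂ x) := by
    rw [hA, hB, ← Finset.sum_sub_distrib]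
    refine Finset.sum_congr rfl fun x _ => ?_
    rw [← Finset.sum_sub_distrib]
    refine Finset.sum_congr rfl fun y _ => ?_
    ring
  have hsum : h₁ u * h₂ v + h₁ v * h₂ u =
      ∑ x ∈ T, ∑ y ∈ T, K u x * K v y * (H₁ x * H₂ y + H₁ y * H₂ x) := by
    rw [hA, hB, ← Finset.sum_add_distrib]
    refine Finset.sum_congr rfl fun x _ => ?_
    rw [← Finset.sum_add_distrib]
    refine Finset.sum_congr rfl fun y _ => ?_
    ring
  rw [hdiff, hsum, Finset.mul_sum]
  refine (Finset.abs_sum_le_sum_abs _ _).trans (Finset.sum_le_sum fun x hx => ?_)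
  rw [Finset.mul_sum]
  refine (Finset.abs_sum_le_sum_abs _ _).trans (Finset.sum_le_sum fun y hy => ?_)
  rw [abs_mul, abs_of_nonneg (mul_nonneg (hK u hu x hx) (hK v hv y hy))]
  have := mul_le_mul_of_nonneg_left (hout x hx y hy) (mul_nonneg (hK u hu x hx) (hK v hv y hy))
  linarith

/-- **Finite-horizon form of `crossDiff_iterate`**: the hypotheses are only required for the
scales `j < q`. [cite: ChelkakWan2021, Corollary 3.8] -/
theorem crossDiff_iterate_fin (h₁ h₂ : ι → ℝ) (q : ℕ) (S : ℕ → Set ι) (T : ℕ → Finset ι)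
    (K : ℕ → ι → ι → ℝ) {C : ℝ} (hC : 1 ≤ C)
    (hpos₁ : ∀ j ≤ q, ∀ x ∈ S j, 0 ≤ h₁ x) (hpos₂ : ∀ j ≤ q, ∀ x ∈ S j, 0 ≤ h₂ x)
    (hT : ∀ j ≤ q, (↑(T j) : Set ι) ⊆ S j)
    (hK : ∀ j < q, ∀ u ∈ S (j + 1), ∀ x ∈ T j, 0 ≤ K j u x)
    (hrep₁ : ∀ j < q, ∀ u ∈ S (j + 1), h₁ u = ∑ x ∈ T j, K j u x * h₁ x)
    (hrep₂ : ∀ j < q, ∀ u ∈ S (j + 1), h₂ u = ∑ x ∈ T j, K j u x * h₂ x)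
    (hcross : ∀ j < q, ∀ u ∈ S (j + 1), ∀ v ∈ S (j + 1), ∀ x ∈ T j, ∀ y ∈ T j,
      K j u x * K j v y ≤ C * (K j v x * K j u y)) :
    ∀ j ≤ q, ∀ u ∈ S j, ∀ v ∈ S j,
      |h₁ u * h₂ v - h₁ v * h₂ u| ≤ ((C - 1) / (C + 1)) ^ j * (h₁ u * h₂ v + h₁ v * h₂ u) := by
  intro j
  induction j with
  | zero =>
    intro _ u hu v hv
    rw [pow_zero]
    exact abs_sub_le_one_mul_add (mul_nonneg (hpos₁ 0 (Nat.zero_le q) u hu) (hpos₂ 0 (Nat.zero_le q) v hv))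
      (mul_nonneg (hpos₁ 0 (Nat.zero_le q) v hv) (hpos₂ 0 (Nat.zero_le q) u hu))
  | succ j ih =>
    intro hj u hu v hv
    have hjq : j < q := Nat.lt_of_succ_le hj
    have step := crossDiff_contraction (S (j + 1)) (T j) (K j) h₁ h₂ h₁ h₂ hC
      (hK j hjq) (fun x hx => hpos₁ j hjq.le x (hT j hjq.le hx)) (fun x hx => hpos₂ j hjq.le x (hT j hjq.le hx))
      (hrep₁ j hjq) (hrep₂ j hjq) (hcross j hjq) (fun x hx y hy => ih hjq.le x (hT j hjq.le hx) y (hT j hjq.le hy))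
      u hu v hv
    simpa only [pow_succ, mul_comm (((C - 1) / (C + 1)) ^ j)] using step

end Algebra

/-! ### Assembly at a boundary point -/

section Assembly

open scoped Classical

variable (D : JordanDomain)

/-- **Uniform boundary Harnack at `b ∈ ∂D` from the one-annulus cross-ratio bound.** Suppose that
for some `K > 1`, `C ≥ 1`, `s₀ > 0` the exit kernels of the lattice germ regions at `b` satisfy,
for all pairs of scales `s < s' = K s < s₀` (and all admissible base/far points), eventually as
`δ → 0`, the cross-ratio bound `P(u,x)P(v,y) ≤ C·P(v,x)P(u,y)` for exits `u, v` of `Θ_δ(s)` and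
`x, y` of `Θ_δ(s')`, `P = killedPoisson (discreteDomainGraph D δ) Θ_δ(s')`. Then for every `R, η > 0`
there is `r > 0` such that, eventually as `δ → 0`, any two nonnegative functions that are discrete
harmonic for the edge-killed walk `Ω^δ` at the sites within `R` of `b` satisfy
`h₁(z) h₂(z') ≤ (1 + η) h₁(z') h₂(z)` at all sites within `r` of `b` (Chelkak–Wan 2021, Prop. 3.6 ⇒
Cor. 3.8, over the germ regions of `GermRegions`/`GermRegionLattice`). [cite: ChelkakWan2021, Corollary 3.8] -/
theorem uniformBHP_at_of_crossRatio {b : ℂ} (hb : b ∈ frontier D.carrier) {K C s₀ : ℝ} (hK : 1 < K)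
    (hC : 1 ≤ C) (hs₀ : 0 < s₀)
    (hU3 : ∀ (s s' : ℝ) (hs : 0 < s) (hs' : 0 < s'), s' = K * s → s' < s₀ →
      ∀ (g o : ℂ), g ∈ D.carrier ∩ pbox b s → o ∈ D.carrier → o ∉ closedBox b s' →
      TwoOff D (boxJD b hs) → TwoOff D (boxJD b hs') →
      ∀ᶠ δ in 𝓝[>] (0 : ℝ),
        ∀ u ∈ germExits D b hs g o δ, ∀ v ∈ germExits D b hs g o δ,
        ∀ x ∈ germExits D b hs' g o δ, ∀ y ∈ germExits D b hs' g o δ,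
          killedPoisson (discreteDomainGraph D.carrier δ) (germSites D b hs' g o δ) u x *
              killedPoisson (discreteDomainGraph D.carrier δ) (germSites D b hs' g o δ) v y ≤
            C * (killedPoisson (discreteDomainGraph D.carrier δ) (germSites D b hs' g o δ) v x *
              killedPoisson (discreteDomainGraph D.carrier δ) (germSites D b hs' g o δ) u y)) :
    ∀ R > (0 : ℝ), ∀ η > (0 : ℝ), ∃ r > (0 : ℝ), ∀ᶠ δ in 𝓝[>] (0 : ℝ), ∀ h₁ h₂ : Site 2 → ℝ,
      (∀ z, 0 ≤ h₁ z) → (∀ z, 0 ≤ h₂ z) →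
      (∀ z ∈ meshDomain D.carrier δ, dist (meshPoint δ z) b < R →
        h₁ z = 4⁻¹ * ∑ e : SRW.Dir 2,
          if (discreteDomainGraph D.carrier δ).Adj z (z + SRW.stepVec e) then h₁ (z + SRW.stepVec e) else 0) →
      (∀ z ∈ meshDomain D.carrier δ, dist (meshPoint δ z) b < R →
        h₂ z = 4⁻¹ * ∑ e : SRW.Dir 2,
          if (discreteDomainGraph D.carrier δ).Adj z (z + SRW.stepVec e) then h₂ (z + SRW.stepVec e) else 0) →
      ∀ z z' : Site 2, z ∈ meshDomain D.carrier δ → z' ∈ meshDomain D.carrier δ →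
        dist (meshPoint δ z) b < r → dist (meshPoint δ z') b < r →
        h₁ z * h₂ z' ≤ (1 + η) * (h₁ z' * h₂ z) := by
  intro R hR η hη
  have hK0 : 0 < K := zero_lt_one.trans hK
  -- ### continuum choices: far point `o`, radius `R'`, master scale, number of scales, base point
  have hbD : b ∉ D.carrier := fun h => by
    have := hb.2; rw [D.isOpen.interior_eq] at this; exact this h
  obtain ⟨o, ho⟩ := D.nonempty
  have hob : 0 < dist o b := dist_pos.2 fun h => hbD (h ▸ ho)
  set R' := min R (dist o b / 2) with hR'
  have hR'0 : 0 < R' := lt_min hR (by positivity)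
  have hR'R : R' ≤ R := min_le_left _ _
  have hR'o : R' < dist o b := by linarith [min_le_right R (dist o b / 2)]
  obtain ⟨s₁, hs₁, hball⟩ := exists_germRegion_subset_closedBall D hR'0
  -- a boundary point other than `b`, for `TwoOff`
  obtain ⟨p, hp, hpb⟩ : ∃ p ∈ frontier D.carrier, p ≠ b := by
    by_cases h0 : D.boundary 0 = b
    · refine ⟨D.boundary (1 / 2), D.boundary_mem_frontier _, fun h => ?_⟩
      have := D.injOn_boundary ⟨le_rfl, by norm_num⟩ ⟨by norm_num, by norm_num⟩ (h0.trans h.symm)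
      norm_num at this
    · exact ⟨D.boundary 0, D.boundary_mem_frontier _, h0⟩
  have hpb' : 0 < dist p b := dist_pos.2 hpb
  -- the contraction ratio and the number of scales
  set k : ℝ := (C - 1) / (C + 1) with hk
  have hk0 : 0 ≤ k := div_nonneg (by linarith) (by linarith)
  have hk1 : k < 1 := by rw [hk, div_lt_one (by linarith)]; linarith
  obtain ⟨q, hq⟩ : ∃ q : ℕ, k ^ q * (2 + η) ≤ η := by
    obtain ⟨q, hq⟩ := exists_pow_lt_of_lt_one (show 0 < η / (2 + η) by positivity) hk1
    exact ⟨q, by rw [lt_div_iff₀ (by positivity)] at hq; exact hq.le⟩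
  -- master scale `S₀` and the scales `sc j = S₀ / K^j`
  set S₀ : ℝ := min (min (s₀ / (2 * K)) s₁) (min (dist p b / 4) (dist o b / 4)) with hS₀
  have hS₀pos : 0 < S₀ := by positivity
  have hS₀a : S₀ ≤ s₀ / (2 * K) := (min_le_left _ _).trans (min_le_left _ _)
  have hS₀b : S₀ ≤ s₁ := (min_le_left _ _).trans (min_le_right _ _)
  have hS₀c : S₀ ≤ dist p b / 4 := (min_le_right _ _).trans (min_le_left _ _)
  have hS₀d : S₀ ≤ dist o b / 4 := (min_le_right _ _).trans (min_le_right _ _)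
  set sc : ℕ → ℝ := fun j => S₀ / K ^ j with hsc
  have hscpos : ∀ j, 0 < sc j := fun j => by positivity
  have hscle : ∀ j, sc j ≤ S₀ := fun j => div_le_self hS₀pos.le (one_le_pow₀ hK.le)
  have hscK : ∀ j, sc j = K * sc (j + 1) := fun j => by
    simp only [hsc, pow_succ]; field_simp
  have hsclt : ∀ j, sc (j + 1) < sc j := fun j => by
    rw [hscK j]; exact lt_mul_left (hscpos _) hK
  have hscmono : ∀ i j, i ≤ j → sc j ≤ sc i := fun i j hij => by
    simp only [hsc]
    exact div_le_div_of_nonneg_left hS₀pos.le (by positivity) (pow_le_pow_right₀ hK.le hij)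
  -- geometric facts valid at every scale `≤ S₀`
  have hTwo : ∀ j, TwoOff D (boxJD b (hscpos j)) := fun j =>
    twoOff_boxJD D (hscpos j) hb fun hsub => by
      have := closedBox_subset_closedBall (hsub hp)
      rw [mem_closedBall] at this
      linarith [hscle j]
  have hoc : ∀ j, o ∉ closedBox b (sc j) := fun j h => by
    have := closedBox_subset_closedBall h
    rw [mem_closedBall] at this
    linarith [hscle j]
  -- base point `g` from uniform local connectedness at the smallest scale
  obtain ⟨ρ, hρ, hρs, hgerm⟩ := exists_ball_inter_subset_chamber D (hscpos q)
  obtain ⟨g, hgD, hgb⟩ : ∃ g ∈ D.carrier, dist g b < ρ := by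
    have : b ∈ closure D.carrier := frontier_subset_closure hb
    obtain ⟨g, hg, hgd⟩ := Metric.mem_closure_iff.1 this ρ hρ
    exact ⟨g, hg, by rw [dist_comm]; exact hgd⟩
  have hgbox : ∀ j ≤ q, g ∈ D.carrier ∩ pbox b (sc j) := fun j hj =>
    ⟨hgD, pbox_mono ((by linarith : ρ ≤ sc q).trans (hscmono j q hj)) (ball_subset_pbox (mem_ball.2 hgb))⟩
  have hchamber : D.carrier ∩ ball b ρ ⊆ chamber D b (sc q) g := hgerm b g hgD hgb
  -- `b` is in the closure of every germ region
  have hbcl : ∀ j ≤ q, b ∈ closure (germRegion D b (hscpos j) g o) := fun j hj => by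
    have h1 : b ∈ closure (D.carrier ∩ ball b ρ) := by
      rw [Metric.mem_closure_iff]
      intro ε hε
      obtain ⟨w, hw, hwd⟩ := Metric.mem_closure_iff.1 (frontier_subset_closure hb) (min ε ρ) (lt_min hε hρ)
      exact ⟨w, ⟨hw, mem_ball.2 (by rw [dist_comm]; exact hwd.trans_le (min_le_right _ _))⟩,
        hwd.trans_le (min_le_left _ _)⟩
    refine closure_mono ?_ h1
    rcases eq_or_lt_of_le hj with rfl | hjq
    · exact hchamber.trans (chamber_subset_germRegion (hgbox j le_rfl))
    · have hlt : sc q < sc j := (hscmono (j + 1) q hjq).trans_lt (hsclt j)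
      exact (hchamber.trans (chamber_subset_germRegion (hgbox q le_rfl))).trans
        (germRegion_mono (hscpos q) hlt (hTwo q) (by convert hTwo j using 2) (hgbox q le_rfl) ho (hoc j))
  -- the germ regions sit inside `closedBall b (R'/2)`
  have hballj : ∀ j ≤ q, germRegion D b (hscpos j) g o ⊆ closedBall b (R' / 2) := fun j hj =>
    hball b (sc j) (hscpos j) ((hscle j).trans hS₀b) hb (hTwo j) g o (hgbox j hj) ho hR'o (hbcl j hj)
  -- ### the radius `r`
  refine ⟨ρ, hρ, ?_⟩
  -- ### eventually in `δ`: positivity, separation of consecutive scales, and the kernel bounds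
  have hev_pos : ∀ᶠ δ in 𝓝[>] (0 : ℝ), 0 < δ := eventually_mem_nhdsWithin
  have hev_small : ∀ᶠ δ in 𝓝[>] (0 : ℝ), 2 * δ < (K - 1) * sc q := by
    have : (0 : ℝ) < (K - 1) * sc q / 2 := by have := hscpos q; nlinarith
    exact (eventually_lt_nhds this).filter_mono nhdsWithin_le_nhds |>.mono fun δ hδ => by linarith
  have hev_U3 : ∀ᶠ δ in 𝓝[>] (0 : ℝ), ∀ j ∈ Finset.range q,
      ∀ u ∈ germExits D b (hscpos (j + 1)) g o δ, ∀ v ∈ germExits D b (hscpos (j + 1)) g o δ,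
      ∀ x ∈ germExits D b (hscpos j) g o δ, ∀ y ∈ germExits D b (hscpos j) g o δ,
        killedPoisson (discreteDomainGraph D.carrier δ) (germSites D b (hscpos j) g o δ) u x *
            killedPoisson (discreteDomainGraph D.carrier δ) (germSites D b (hscpos j) g o δ) v y ≤
          C * (killedPoisson (discreteDomainGraph D.carrier δ) (germSites D b (hscpos j) g o δ) v x *
            killedPoisson (discreteDomainGraph D.carrier δ) (germSites D b (hscpos j) g o δ) u y) := by
    rw [Finset.eventually_all]
    intro j hj
    rw [Finset.mem_range] at hj
    have hlt : sc j < s₀ := by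
      have h1 := hscle j
      have h2 : s₀ / (2 * K) < s₀ := by
        rw [div_lt_iff₀ (by positivity)]; nlinarith
      linarith
    exact hU3 (sc (j + 1)) (sc j) (hscpos (j + 1)) (hscpos j) (hscK j) hlt g o (hgbox (j + 1) (by omega)) ho
      (hoc j) (hTwo (j + 1)) (hTwo j)
  filter_upwards [hev_pos, hev_small, hev_U3] with δ hδ hδs hU
  intro h₁ h₂ h₁0 h₂0 hh₁ hh₂ z z' hz hz' hzb hz'b
  -- ### the discrete objects at this `δ`
  set Gr := discreteDomainGraph D.carrier δ
  set Θ : ℕ → Set (Site 2) := fun j => germSites D b (hscpos j) g o δ with hΘ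
  have hΘfin : ∀ j, (Θ j).Finite := fun j => germSites_finite hδ
  set T : ℕ → Finset (Site 2) := fun j => (killedOuterBoundary_finite (Gr := Gr) (hΘfin j)).toFinset with hT
  have hTE : ∀ j, (↑(T j) : Set (Site 2)) = germExits D b (hscpos j) g o δ := fun j => by
    simp only [hT, Set.Finite.coe_toFinset]; rfl
  have hmemT : ∀ j x, x ∈ T j ↔ x ∈ germExits D b (hscpos j) g o δ := fun j x => by
    rw [← Finset.mem_coe, hTE]
  -- harmonicity on every `Θ j`, `j ≤ q`
  have hharm : ∀ (h : Site 2 → ℝ), (∀ z ∈ meshDomain D.carrier δ, dist (meshPoint δ z) b < R →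
      h z = 4⁻¹ * ∑ e : SRW.Dir 2, if Gr.Adj z (z + SRW.stepVec e) then h (z + SRW.stepVec e) else 0) →
      ∀ j ≤ q, IsKilledHarmonicOn Gr h (Θ j) := fun h hh j hj w hw => by
    have hwR : dist (meshPoint δ w) b < R := by
      have := germSites_subset_ball (hballj j hj) hw
      linarith
    exact hh w hw.1 hwR
  -- exits of `Θ (j+1)` are sites of `Θ j`
  have hsep : ∀ j < q, sc (j + 1) + 2 * δ < sc j := fun j hj => by
    have h1 : sc q ≤ sc (j + 1) := hscmono (j + 1) q hj
    have h2 := hscK j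
    nlinarith
  have hET : ∀ j < q, germExits D b (hscpos (j + 1)) g o δ ⊆ Θ j := fun j hj =>
    germExits_subset_germSites (hTwo (j + 1)) (hgbox (j + 1) (by omega)) ho (hoc (j + 1)) hδ (hsep j hj)
      (by convert hTwo j using 2) (hoc j)
  -- representation through the exits of `Θ j`
  have hrep : ∀ (h : Site 2 → ℝ), (∀ j ≤ q, IsKilledHarmonicOn Gr h (Θ j)) → ∀ j ≤ q, ∀ u ∈ Θ j,
      h u = ∑ x ∈ T j, killedPoisson Gr (Θ j) u x * h x := fun h hh j hj u hu =>
    (hh j hj).eq_sum_killedPoisson (hΘfin j) u hu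
  -- ### the iteration over the scales
  have iter := crossDiff_iterate_fin h₁ h₂ q (fun j => germExits D b (hscpos j) g o δ) T
    (fun j u x => killedPoisson Gr (Θ j) u x) hC
    (fun j _ x _ => h₁0 x) (fun j _ x _ => h₂0 x)
    (fun j _ => (hTE j).le)
    (fun j _ u _ x _ => killedPoisson_nonneg (hΘfin j) u x)
    (fun j hj u hu => hrep h₁ (hharm h₁ hh₁) j hj.le u (hET j hj hu))
    (fun j hj u hu => hrep h₂ (hharm h₂ hh₂) j hj.le u (hET j hj hu))
    (fun j hj u hu v hv x hx y hy => hU j (Finset.mem_range.2 hj) u hu v hv x ((hmemT j x).1 hx) y ((hmemT j y).1 hy))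
    q le_rfl
  -- ### the interior points `z, z'` lie in `Θ q`
  have hzΘ : z ∈ Θ q := mem_germSites_of_dist_lt (hgbox q le_rfl) hchamber hz hzb
  have hz'Θ : z' ∈ Θ q := mem_germSites_of_dist_lt (hgbox q le_rfl) hchamber hz' hz'b
  have final := crossDiff_mixture_le (Θ q) (T q) (fun u x => killedPoisson Gr (Θ q) u x) h₁ h₂ h₁ h₂
    (fun u _ x _ => killedPoisson_nonneg (hΘfin q) u x)
    (fun u hu => hrep h₁ (hharm h₁ hh₁) q le_rfl u hu) (fun u hu => hrep h₂ (hharm h₂ hh₂) q le_rfl u hu)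
    (fun x hx y hy => iter x ((hmemT q x).1 hx) y ((hmemT q y).1 hy)) z hzΘ z' hz'Θ
  exact le_mul_of_abs_sub_le (mul_nonneg (h₁0 z') (h₂0 z)) hη.le hq final

/-- **Uniform BHP (the `hBHP` input of `KozdronLawler2005_martinRatioBoundaryLimit_of_uniformBHP`)
from the one-annulus cross-ratio bound at every boundary point.** [cite: ChelkakWan2021, Corollary 3.8] -/
theorem uniformBHP_of_crossRatio
    (hcore : ∀ (D : JordanDomain), ∀ b ∈ frontier D.carrier, ∃ K C s₀ : ℝ, 1 < K ∧ 1 ≤ C ∧ 0 < s₀ ∧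
      ∀ (s s' : ℝ) (hs : 0 < s) (hs' : 0 < s'), s' = K * s → s' < s₀ →
      ∀ (g o : ℂ), g ∈ D.carrier ∩ pbox b s → o ∈ D.carrier → o ∉ closedBox b s' →
      TwoOff D (boxJD b hs) → TwoOff D (boxJD b hs') →
      ∀ᶠ δ in 𝓝[>] (0 : ℝ),
        ∀ u ∈ germExits D b hs g o δ, ∀ v ∈ germExits D b hs g o δ,
        ∀ x ∈ germExits D b hs' g o δ, ∀ y ∈ germExits D b hs' g o δ,
          killedPoisson (discreteDomainGraph D.carrier δ) (germSites D b hs' g o δ) u x *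
              killedPoisson (discreteDomainGraph D.carrier δ) (germSites D b hs' g o δ) v y ≤
            C * (killedPoisson (discreteDomainGraph D.carrier δ) (germSites D b hs' g o δ) v x *
              killedPoisson (discreteDomainGraph D.carrier δ) (germSites D b hs' g o δ) u y)) :
    ∀ (D : JordanDomain), ∀ b ∈ frontier D.carrier, ∀ R > (0 : ℝ), ∀ η > (0 : ℝ),
      ∃ r > (0 : ℝ), ∀ᶠ δ in 𝓝[>] (0 : ℝ), ∀ h₁ h₂ : Site 2 → ℝ,
        (∀ z, 0 ≤ h₁ z) → (∀ z, 0 ≤ h₂ z) →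
        (∀ z ∈ meshDomain D.carrier δ, dist (meshPoint δ z) b < R →
          h₁ z = 4⁻¹ * ∑ e : SRW.Dir 2,
            if (discreteDomainGraph D.carrier δ).Adj z (z + SRW.stepVec e)
            then h₁ (z + SRW.stepVec e) else 0) →
        (∀ z ∈ meshDomain D.carrier δ, dist (meshPoint δ z) b < R →
          h₂ z = 4⁻¹ * ∑ e : SRW.Dir 2,
            if (discreteDomainGraph D.carrier δ).Adj z (z + SRW.stepVec e)
            then h₂ (z + SRW.stepVec e) else 0) →
        ∀ z z' : Site 2, z ∈ meshDomain D.carrier δ → z' ∈ meshDomain D.carrier δ →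
          dist (meshPoint δ z) b < r → dist (meshPoint δ z') b < r →
          h₁ z * h₂ z' ≤ (1 + η) * (h₁ z' * h₂ z) := by
  intro D b hb R hR η hη
  obtain ⟨K, C, s₀, hK, hC, hs₀, hU3⟩ := hcore D b hb
  exact uniformBHP_at_of_crossRatio D hb hK hC hs₀ hU3 R hR η hη

/-- **The Kozdron–Lawler Martin-ratio boundary limit from the one-annulus cross-ratio bound.**
Combining `uniformBHP_of_crossRatio` with `KozdronLawler2005_martinRatioBoundaryLimit_of_uniformBHP`
(Green-kernel convergence is already unconditional there): the fact
`KozdronLawler2005_martinRatioBoundaryLimit` follows from the scale-invariant crude boundary Harnack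
bound for the exit kernels of the lattice germ regions. [cite: KozdronLawler2005, Prop. 3.8; ChelkakWan2021, Cor. 3.8] -/
theorem KozdronLawler2005_martinRatioBoundaryLimit_of_crossRatio
    (hcore : ∀ (D : JordanDomain), ∀ b ∈ frontier D.carrier, ∃ K C s₀ : ℝ, 1 < K ∧ 1 ≤ C ∧ 0 < s₀ ∧
      ∀ (s s' : ℝ) (hs : 0 < s) (hs' : 0 < s'), s' = K * s → s' < s₀ →
      ∀ (g o : ℂ), g ∈ D.carrier ∩ pbox b s → o ∈ D.carrier → o ∉ closedBox b s' →
      TwoOff D (boxJD b hs) → TwoOff D (boxJD b hs') →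
      ∀ᶠ δ in 𝓝[>] (0 : ℝ),
        ∀ u ∈ germExits D b hs g o δ, ∀ v ∈ germExits D b hs g o δ,
        ∀ x ∈ germExits D b hs' g o δ, ∀ y ∈ germExits D b hs' g o δ,
          killedPoisson (discreteDomainGraph D.carrier δ) (germSites D b hs' g o δ) u x *
              killedPoisson (discreteDomainGraph D.carrier δ) (germSites D b hs' g o δ) v y ≤
            C * (killedPoisson (discreteDomainGraph D.carrier δ) (germSites D b hs' g o δ) v x *
              killedPoisson (discreteDomainGraph D.carrier δ) (germSites D b hs' g o δ) u y)) :
    KozdronLawler2005_martinRatioBoundaryLimit :=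
  KozdronLawler2005_martinRatioBoundaryLimit_of_uniformBHP (uniformBHP_of_crossRatio hcore)

end Assembly

end Literature.Probability.LatticeModels
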